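import Mathlib
import HarnessLib
import Literature.Dynamics.Ergodic.BirkhoffErgodicTheoremProofs
import Summits.Ventures.LatticeQCDFlow.Exactness.NCMCGeneralSpaceEstimatorConsistency
import Summits.Ventures.LatticeQCDFlow.Exactness.NCMCGeneralSpaceMonotoneRootConsistency

/-!
# Correlated starts: the engine's estimators along ONE stationary ergodic stream of evolutions

HONEST FRAMING: exact (Metropolis-corrected) sampling algorithms for lattice gauge theory;
figures of merit are autocorrelation/cost numbers at stated couplings and volumes; no
continuum-physics claim.

Venture `LatticeQCDFlow` (cell pub-lqcd), topic `Exactness`; FANOUT row 13 (`eng-snf`, GEN-16).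
NEW WORK of the cell, not a published result; no definition is introduced.  The one cited input is
Birkhoff's pointwise ergodic theorem, which is a PROVED fact of the tree
(`Literature.Dynamics.Ergodic.birkhoff_ergodic_theorem_of_ergodic_holds`, Dajani–Kalle Thm 3.1.1 /
Durrett Thm 6.2.1); nothing else is cited (the practice of launching non-equilibrium evolutions
every `n_between` updates of ONE equilibrium Markov chain — Bonanno–Nada–Vadacchino,
arXiv:2409.18861 §3; the NE-MCMC / SNF literature generally — is named only).

## Why

Every sampling statement of GEN-11–GEN-15 (`NCMCGeneralSpaceEstimatorConsistency.lean`, the CLT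
files, the Bennett-root files) is about INDEPENDENT evolutions: law `Measure.infinitePi (fun _ ↦ P_F)`.
The engine (`latflow-snf`, `run_ncmc_chain`, levers `n_between` / `n_therm`) does not sample that
law: the start configurations are read every `n_between` sweeps off one equilibrium chain at the
prior level, so consecutive evolution records are correlated.  This file types what survives:
STRONG CONSISTENCY of every point estimate the engine reports needs only that the stream of
records be STATIONARY and ERGODIC for the time shift, with the equilibrium one-record marginal —
no independence, no mixing rate, no bounded observables (the Jarzynski weight `e^{−W}` is
unbounded; Birkhoff needs `L¹` only, and `E_F e^{−W} = e^{−ΔF} < ∞` is automatic).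

## Setting

Records `E`; a stream is `ω : ℕ → E`; the shift is written inline as
`fun (ω : ℕ → E) (k : ℕ) ↦ ω (k + 1)`; `P` is a probability law on streams with
`Ergodic (shift) P` (Mathlib: measure preserving + every strictly invariant measurable set is
a.e. trivial) and one-record marginal `P.map (fun ω ↦ ω 0) = μ` (think `μ = P_F = fwdPathLaw ν₀ κF`).

## Content

* `shift_iterate_apply`, `measurable_shift`, `birkhoffSum_shift`, `birkhoffAverage_shift` — the
  Birkhoff averages of `ω ↦ φ(ω 0)` along the shift ARE the running sample means
  `(1/n) Σ_{i<n} φ(ω i)`.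
* **`tendsto_sum_div_ae_of_ergodic`** / `tendsto_sampleMean_ae_of_ergodic` — the strong law along
  a stationary ergodic stream: `(1/n) Σ_{i<n} φ(ω i) → E_μ φ` a.s. for every `φ ∈ L¹(μ)`.
* **`tendsto_jarzynskiEstimate_ae_of_ergodic`** (`ΔF̂_n → −log E_μ w`),
  **`tendsto_essHat_ae_of_ergodic`** (Kish fraction `→ (E_μ w)²/E_μ w²`),
  **`tendsto_ratio_ae_of_ergodic`** (self-normalised ratios `Σ a(ω i)/Σ b(ω i) → E_μ a / E_μ b`).
* `eventually_rootSum_sign_of_tendsto`, `tendsto_root_of_eventually_sign` — the DETERMINISTIC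
  heart of GEN-15's root consistency (`NCMCGeneralSpaceMonotoneRootConsistency.lean`): for one
  stream, convergence of the averaged estimating function at the countably many levels
  `d⋆ ± 1/(k+1)` already forces eventual sign separation and convergence of EVERY root sequence;
  **`tendsto_root_ae_of_ergodic`** — hence monotone one-parameter equations solved from an
  ergodic stream are strongly consistent.

Companion files: `NCMCGeneralSpaceErgodicRunCrooks.lean` (the Crooks-pair corollaries: `ΔF̂_n → ΔF`,
reweighted observables, the Bennett root, along ergodic streams with marginal `P_F` / `P_R`);
`NCMCGeneralSpaceStationaryRun.lean` (what stationarity alone gives); `NCMCGeneralSpaceIIDRunErgodic.lean`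
(independent evolutions are the special case: `Measure.infinitePi` is shift-ergodic).  NOT CLAIMED:
that any concrete sampler's stream is ergodic (a property of the level sampler — heat-bath /
overrelaxation sweeps — to be certified separately); rates, error bars or a CLT for correlated
streams (those need mixing information, cf. row 8's Doeblin files `Scoring/ChainTimeAverage.lean`
for bounded observables).
-/

namespace Summit.Ventures.LatticeQCDFlow.Exactness.GeneralNCMC

open MeasureTheory ProbabilityTheory Set Filter Finset
open scoped ENNReal Topology

variable {E : Type*} [MeasurableSpace E]

/-! ## The shift on streams of records and its Birkhoff averages -/

section Shift

omit [MeasurableSpace E] in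
/-- Iterating the shift `i` times reads the stream `i` places later. -/
theorem shift_iterate_apply (ω : ℕ → E) (i k : ℕ) :
    ((fun (ω : ℕ → E) (k : ℕ) => ω (k + 1))^[i] ω) k = ω (k + i) := by
  induction i generalizing ω with
  | zero => rfl
  | succ i ih =>
    rw [Function.iterate_succ_apply, ih]
    rfl

/-- The shift is measurable for the product σ-algebra. -/
theorem measurable_shift : Measurable (fun (ω : ℕ → E) (k : ℕ) => ω (k + 1)) :=
  measurable_pi_lambda _ fun k => measurable_pi_apply (k + 1)

omit [MeasurableSpace E] in
/-- The Birkhoff sums of a one-record observable along the shift are the running sums. -/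
theorem birkhoffSum_shift (φ : E → ℝ) (n : ℕ) (ω : ℕ → E) :
    birkhoffSum (fun (ω : ℕ → E) (k : ℕ) => ω (k + 1)) (fun ω => φ (ω 0)) n ω =
      ∑ i ∈ range n, φ (ω i) := by
  unfold birkhoffSum
  refine sum_congr rfl fun i _ => ?_
  dsimp only
  rw [shift_iterate_apply, Nat.zero_add]

omit [MeasurableSpace E] in
/-- The Birkhoff averages of a one-record observable along the shift are the running sample means. -/
theorem birkhoffAverage_shift (φ : E → ℝ) (n : ℕ) (ω : ℕ → E) :
    birkhoffAverage ℝ (fun (ω : ℕ → E) (k : ℕ) => ω (k + 1)) (fun ω => φ (ω 0)) n ω =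
      (∑ i ∈ range n, φ (ω i)) / n := by
  rw [birkhoffAverage.eq_1, birkhoffSum_shift, smul_eq_mul, div_eq_inv_mul]

end Shift

/-! ## The strong law along a stationary ergodic stream -/

section Ergodic

variable {P : Measure (ℕ → E)} {μ : Measure E}

/-- A one-record observable integrates over the stream law to its `μ`-mean. -/
theorem integral_comp_eval_zero (hμ : P.map (fun ω => ω 0) = μ) {φ : E → ℝ}
    (hφ : AEStronglyMeasurable φ μ) : ∫ ω, φ (ω 0) ∂P = ∫ a, φ a ∂μ := by
  rw [← integral_map (measurable_pi_apply 0).aemeasurable (by rw [hμ]; exact hφ), hμ]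

/-- A `μ`-integrable one-record observable is integrable over the stream law. -/
theorem integrable_comp_eval_zero (hμ : P.map (fun ω => ω 0) = μ) {φ : E → ℝ}
    (hφ : Integrable φ μ) : Integrable (fun ω : ℕ → E => φ (ω 0)) P := by
  rw [← hμ] at hφ
  exact hφ.comp_measurable (measurable_pi_apply 0)

variable [IsProbabilityMeasure P]

/-- The one-record marginal of a probability law on streams is a probability law. -/
theorem isProbabilityMeasure_of_map_eval (hμ : P.map (fun ω => ω 0) = μ) :
    IsProbabilityMeasure μ :=
  hμ ▸ Measure.isProbabilityMeasure_map (measurable_pi_apply 0).aemeasurable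

/-- **The strong law along a stationary ergodic stream of records** (Birkhoff): for every
`φ ∈ L¹(μ)`, `(1/n) Σ_{i<n} φ(ω i) → E_μ φ` for `P`-almost every stream. -/
theorem tendsto_sum_div_ae_of_ergodic (hP : Ergodic (fun (ω : ℕ → E) (k : ℕ) => ω (k + 1)) P)
    (hμ : P.map (fun ω => ω 0) = μ) {φ : E → ℝ} (hφ : Integrable φ μ) :
    ∀ᵐ ω ∂P, Tendsto (fun n : ℕ => (∑ i ∈ range n, φ (ω i)) / n) atTop (𝓝 (∫ a, φ a ∂μ)) := by
  have hB := Literature.Dynamics.Ergodic.birkhoff_ergodic_theorem_of_ergodic_holds P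
    (fun (ω : ℕ → E) (k : ℕ) => ω (k + 1)) hP (fun ω => φ (ω 0)) (integrable_comp_eval_zero hμ hφ)
  rw [integral_comp_eval_zero hμ hφ.aestronglyMeasurable] at hB
  filter_upwards [hB] with ω hω
  exact hω.congr fun n => birkhoffAverage_shift φ n ω

/-- The same in the vocabulary of `JarzynskiEstimatorBias.sampleMean`. -/
theorem tendsto_sampleMean_ae_of_ergodic (hP : Ergodic (fun (ω : ℕ → E) (k : ℕ) => ω (k + 1)) P)
    (hμ : P.map (fun ω => ω 0) = μ) {φ : E → ℝ} (hφ : Integrable φ μ) :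
    ∀ᵐ ω ∂P, Tendsto (fun n : ℕ => sampleMean φ (fun i : Fin n => ω i)) atTop
      (𝓝 (∫ a, φ a ∂μ)) := by
  filter_upwards [tendsto_sum_div_ae_of_ergodic hP hμ hφ] with ω hω
  refine hω.congr fun n => ?_
  unfold sampleMean
  rw [Fin.sum_univ_eq_sum_range (fun i => φ (ω i)) n]

/-- **Strong consistency of the Jarzynski estimate along an ergodic stream**: for a positive weight
`w ∈ L¹(μ)`, `−log ((1/n) Σ_{i<n} w(ω i)) → −log E_μ w` a.s. -/
theorem tendsto_jarzynskiEstimate_ae_of_ergodic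
    (hP : Ergodic (fun (ω : ℕ → E) (k : ℕ) => ω (k + 1)) P) (hμ : P.map (fun ω => ω 0) = μ)
    {w : E → ℝ} (hwpos : ∀ a, 0 < w a) (hwi : Integrable w μ) :
    ∀ᵐ ω ∂P, Tendsto (fun n : ℕ => jarzynskiEstimate w (fun i : Fin n => ω i)) atTop
      (𝓝 (-Real.log (∫ a, w a ∂μ))) := by
  haveI := isProbabilityMeasure_of_map_eval hμ
  have hpos : 0 < ∫ a, w a ∂μ := by
    rw [integral_pos_iff_support_of_nonneg (fun a => (hwpos a).le) hwi]
    have hsupp : Function.support w = univ := by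
      ext a
      simp only [Function.mem_support, mem_univ, iff_true]
      exact (hwpos a).ne'
    rw [hsupp, measure_univ]
    exact one_pos
  filter_upwards [tendsto_sampleMean_ae_of_ergodic hP hμ hwi] with ω hω
  unfold jarzynskiEstimate
  exact (hω.log hpos.ne').neg

/-- **Strong consistency of the Kish fraction along an ergodic stream**: for `w ∈ L²(μ)` with
`E_μ w² ≠ 0`, `essHat (w(ω i))_{i<n} → (E_μ w)² / E_μ w²` a.s. -/
theorem tendsto_essHat_ae_of_ergodic (hP : Ergodic (fun (ω : ℕ → E) (k : ℕ) => ω (k + 1)) P)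
    (hμ : P.map (fun ω => ω 0) = μ) {w : E → ℝ} (hL2 : MemLp w 2 μ)
    (hsq : ∫ a, w a ^ 2 ∂μ ≠ 0) :
    ∀ᵐ ω ∂P, Tendsto (fun n : ℕ => essHat (fun i : Fin n => w (ω i))) atTop
      (𝓝 ((∫ a, w a ∂μ) ^ 2 / ∫ a, w a ^ 2 ∂μ)) := by
  haveI := isProbabilityMeasure_of_map_eval hμ
  have h1 := tendsto_sampleMean_ae_of_ergodic hP hμ (hL2.integrable one_le_two)
  have h2 := tendsto_sampleMean_ae_of_ergodic hP hμ hL2.integrable_sq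
  filter_upwards [h1, h2] with ω hω1 hω2
  have hlim : Tendsto (fun n : ℕ => (sampleMean w fun i : Fin n => ω i) ^ 2 /
      sampleMean (fun x => w x ^ 2) fun i : Fin n => ω i) atTop
      (𝓝 ((∫ a, w a ∂μ) ^ 2 / ∫ a, w a ^ 2 ∂μ)) := (hω1.pow 2).div hω2 hsq
  refine hlim.congr' ?_
  filter_upwards [eventually_gt_atTop 0] with n hn
  simp only [essHat, sampleMean, Fintype.card_fin]
  have hn' : (n : ℝ) ≠ 0 := by exact_mod_cast hn.ne'
  rcases eq_or_ne (∑ i : Fin n, w (ω i) ^ 2) 0 with hz | hz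
  · rw [hz, zero_div, mul_zero, div_zero, div_zero]
  · field_simp

/-- **Strong consistency of self-normalised ratios along an ergodic stream**: for `a, b ∈ L¹(μ)`
with `E_μ b ≠ 0`, `Σ_{i<n} a(ω i) / Σ_{i<n} b(ω i) → E_μ a / E_μ b` a.s. -/
theorem tendsto_ratio_ae_of_ergodic (hP : Ergodic (fun (ω : ℕ → E) (k : ℕ) => ω (k + 1)) P)
    (hμ : P.map (fun ω => ω 0) = μ) {a b : E → ℝ} (ha : Integrable a μ) (hb : Integrable b μ)
    (hb0 : ∫ x, b x ∂μ ≠ 0) :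
    ∀ᵐ ω ∂P, Tendsto (fun n : ℕ => (∑ i ∈ range n, a (ω i)) / ∑ i ∈ range n, b (ω i)) atTop
      (𝓝 ((∫ x, a x ∂μ) / ∫ x, b x ∂μ)) := by
  filter_upwards [tendsto_sum_div_ae_of_ergodic hP hμ ha, tendsto_sum_div_ae_of_ergodic hP hμ hb]
    with ω hωa hωb
  refine ((hωa.div hωb hb0).congr' ?_)
  filter_upwards [eventually_gt_atTop 0] with n hn
  have hn' : (n : ℝ) ≠ 0 := by exact_mod_cast hn.ne'
  rw [Pi.div_apply, div_div_div_cancel_right₀ hn']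

end Ergodic

/-! ## Monotone estimating equations: the deterministic core, then the ergodic strong consistency -/

section Root

variable {X : Type*} {ψ : ℝ → X → ℝ}

/-- **Eventual sign separation for ONE stream (deterministic).**  If `d ↦ ψ_d(x)` is strictly
increasing for every record, the population function `G` is strictly increasing with `G(d⋆) = 0`,
and along the stream `ω` the averaged estimating function converges to `G` at the levels
`d⋆ ± 1/(k+1)`, `k ∈ ℕ`, then for every `δ > 0` and all large `n`: `Σ_{i<n} ψ_d(ω i) < 0` for every
`d ≤ d⋆ − δ` and `> 0` for every `d ≥ d⋆ + δ`. -/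
theorem eventually_rootSum_sign_of_tendsto (hstrict : ∀ x, StrictMono fun d => ψ d x)
    {G : ℝ → ℝ} (hG : StrictMono G) {dstar : ℝ} (hroot : G dstar = 0) {ω : ℕ → X}
    (hup : ∀ k : ℕ, Tendsto (fun n : ℕ => (∑ i ∈ range n, ψ (dstar + 1 / (k + 1)) (ω i)) / n) atTop
      (𝓝 (G (dstar + 1 / (k + 1)))))
    (hdn : ∀ k : ℕ, Tendsto (fun n : ℕ => (∑ i ∈ range n, ψ (dstar - 1 / (k + 1)) (ω i)) / n) atTop
      (𝓝 (G (dstar - 1 / (k + 1))))) :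
    ∀ δ : ℝ, 0 < δ → ∀ᶠ n : ℕ in atTop,
      (∀ d ≤ dstar - δ, ∑ i ∈ range n, ψ d (ω i) < 0) ∧
      (∀ d ≥ dstar + δ, 0 < ∑ i ∈ range n, ψ d (ω i)) := by
  intro δ hδ
  obtain ⟨k, hk⟩ := exists_nat_one_div_lt hδ
  have hkpos : (0 : ℝ) < 1 / ((k : ℝ) + 1) := by positivity
  have hGup : 0 < G (dstar + 1 / (k + 1)) := by
    have := hG (show dstar < dstar + 1 / (k + 1) by linarith)
    linarith
  have hGdn : G (dstar - 1 / (k + 1)) < 0 := by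
    have := hG (show dstar - 1 / (k + 1) < dstar by linarith)
    linarith
  filter_upwards [(hup k).eventually (lt_mem_nhds hGup), (hdn k).eventually (gt_mem_nhds hGdn),
    eventually_gt_atTop 0] with n hnup hndn hn
  have hn' : (0 : ℝ) < n := by exact_mod_cast hn
  have hposup : 0 < ∑ i ∈ range n, ψ (dstar + 1 / (k + 1)) (ω i) := by
    by_contra hle
    have : (∑ i ∈ range n, ψ (dstar + 1 / (k + 1)) (ω i)) / n ≤ 0 :=
      div_nonpos_of_nonpos_of_nonneg (not_lt.1 hle) hn'.le
    linarith
  have hnegdn : ∑ i ∈ range n, ψ (dstar - 1 / (k + 1)) (ω i) < 0 := by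
    by_contra hle
    have : 0 ≤ (∑ i ∈ range n, ψ (dstar - 1 / (k + 1)) (ω i)) / n :=
      div_nonneg (not_lt.1 hle) hn'.le
    linarith
  have hmono := rootSum_monotone hstrict ω n
  constructor
  · intro d hd
    have h1 := hmono (show d ≤ dstar - 1 / (k + 1) by linarith)
    dsimp only at h1
    linarith
  · intro d hd
    have h1 := hmono (show dstar + 1 / (k + 1) ≤ d by linarith)
    dsimp only at h1
    linarith

/-- **Every root sequence converges (deterministic)**: eventual sign separation at every `δ > 0`
forces every sequence `d_n` solving `Σ_{i<n} ψ_{d_n}(ω i) = 0` for all large `n` to converge to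
`d⋆`. -/
theorem tendsto_root_of_eventually_sign {dstar : ℝ} {ω : ℕ → X}
    (hsign : ∀ δ : ℝ, 0 < δ → ∀ᶠ n : ℕ in atTop,
      (∀ d ≤ dstar - δ, ∑ i ∈ range n, ψ d (ω i) < 0) ∧
      (∀ d ≥ dstar + δ, 0 < ∑ i ∈ range n, ψ d (ω i)))
    {dseq : ℕ → ℝ} (hdseq : ∀ᶠ n : ℕ in atTop, ∑ i ∈ range n, ψ (dseq n) (ω i) = 0) :
    Tendsto dseq atTop (𝓝 dstar) := by
  rw [Metric.tendsto_atTop]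
  intro ε hε
  obtain ⟨N, hN⟩ := ((hsign ε hε).and hdseq).exists_forall_of_atTop
  refine ⟨N, fun n hn => ?_⟩
  obtain ⟨⟨hlo, hhi⟩, hz⟩ := hN n hn
  rw [Real.dist_eq, abs_lt]
  constructor
  · by_contra hle
    have := hlo (dseq n) (by linarith)
    linarith
  · by_contra hle
    have := hhi (dseq n) (by linarith)
    linarith

variable [MeasurableSpace X] {P : Measure (ℕ → X)} [IsProbabilityMeasure P] {μ : Measure X}

/-- **Eventual sign separation along an ergodic stream**: for a strictly increasing, `μ`-integrable
family `ψ_d` with population root `E_μ ψ_{d⋆} = 0`, almost every stream drawn from a stationary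
ergodic law with one-record marginal `μ` separates signs around `d⋆` eventually. -/
theorem eventually_rootSum_sign_ae_of_ergodic
    (hP : Ergodic (fun (ω : ℕ → X) (k : ℕ) => ω (k + 1)) P) (hμ : P.map (fun ω => ω 0) = μ)
    (hstrict : ∀ x, StrictMono fun d => ψ d x) (hint : ∀ d, Integrable (ψ d) μ) {dstar : ℝ}
    (hroot : ∫ x, ψ dstar x ∂μ = 0) :
    ∀ᵐ ω ∂P, ∀ δ : ℝ, 0 < δ → ∀ᶠ n : ℕ in atTop,
      (∀ d ≤ dstar - δ, ∑ i ∈ range n, ψ d (ω i) < 0) ∧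
      (∀ d ≥ dstar + δ, 0 < ∑ i ∈ range n, ψ d (ω i)) := by
  haveI := isProbabilityMeasure_of_map_eval hμ
  have hup : ∀ᵐ ω ∂P, ∀ k : ℕ,
      Tendsto (fun n : ℕ => (∑ i ∈ range n, ψ (dstar + 1 / (k + 1)) (ω i)) / n) atTop
        (𝓝 (∫ x, ψ (dstar + 1 / (k + 1)) x ∂μ)) :=
    ae_all_iff.2 fun k => tendsto_sum_div_ae_of_ergodic hP hμ (hint _)
  have hdn : ∀ᵐ ω ∂P, ∀ k : ℕ,
      Tendsto (fun n : ℕ => (∑ i ∈ range n, ψ (dstar - 1 / (k + 1)) (ω i)) / n) atTop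
        (𝓝 (∫ x, ψ (dstar - 1 / (k + 1)) x ∂μ)) :=
    ae_all_iff.2 fun k => tendsto_sum_div_ae_of_ergodic hP hμ (hint _)
  filter_upwards [hup, hdn] with ω hωup hωdn
  exact eventually_rootSum_sign_of_tendsto hstrict (G := fun d => ∫ x, ψ d x ∂μ)
    (strictMono_integral_family μ hstrict hint) hroot hωup hωdn

/-- **Strong consistency of monotone roots along an ergodic stream**: outside ONE null set, every
sequence solving the sample equation `Σ_{i<n} ψ_{d_n}(ω i) = 0` for all large `n` converges to the
population root `d⋆`. -/
theorem tendsto_root_ae_of_ergodic (hP : Ergodic (fun (ω : ℕ → X) (k : ℕ) => ω (k + 1)) P)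
    (hμ : P.map (fun ω => ω 0) = μ) (hstrict : ∀ x, StrictMono fun d => ψ d x)
    (hint : ∀ d, Integrable (ψ d) μ) {dstar : ℝ} (hroot : ∫ x, ψ dstar x ∂μ = 0) :
    ∀ᵐ ω ∂P, ∀ dseq : ℕ → ℝ,
      (∀ᶠ n : ℕ in atTop, ∑ i ∈ range n, ψ (dseq n) (ω i) = 0) → Tendsto dseq atTop (𝓝 dstar) := by
  filter_upwards [eventually_rootSum_sign_ae_of_ergodic hP hμ hstrict hint hroot] with ω hω dseq hdseq
  exact tendsto_root_of_eventually_sign hω hdseq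

end Root

end Summit.Ventures.LatticeQCDFlow.Exactness.GeneralNCMC
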